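import Mathlib.Analysis.Calculus.FDeriv.Basic
import Mathlib.Analysis.Calculus.Deriv.Basic
import Mathlib.Analysis.Calculus.IteratedDeriv.Defs
import Mathlib.Analysis.Calculus.ContDiff.Defs
import Mathlib.Analysis.SpecialFunctions.Pow.Real
import Mathlib.Geometry.Euclidean.Angle.Unoriented.Basic
import Literature.Geometry.Lorentzian.Basic
import HarnessLib

/-!
# Parabolic Hölder spaces in the logarithmic radius on exterior tails `(r_*, R] × S²`
(Ellithy 2026, arXiv:2605.18730, §3.1, Definitions 3.1, 3.2, 3.4)

A. Ellithy, *The spacetime Penrose inequality under a quasi final state hypothesis* (2026),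
§3.1 "Preliminaries and Function Spaces" (p. 20): "we work on the open exterior region of the
spacetime … `M := ℝ³ ∖ B̄_{r₀} ≅ (r₀, ∞) × S²` … we introduce the logarithmic radial variable
`s := -log r` … Given `r₀ ≤ r_* < R ≤ ∞`, define `M_{r_*,R} := (r_*, R] × S²` … Fix once and for all a
smooth reference metric on `S²`, say the round metric `γ_{S²}`, and let `D̸` denote its Levi–Civita
connection. We use the associated parabolic distance in the `s`-variable
`d_p((s,x),(s',y)) := d_{γ_{S²}}(x,y) + |s - s'|^{1/2}`. For `α ∈ (0,1)` and a function `v` on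
`M_{r_*,R}`, define the parabolic Hölder seminorm by
`[v]_{α,α/2;M_{r_*,R}} := sup_{(s,x) ≠ (s',y)} |v(s,x) - v(s',y)| / d_p((s,x),(s',y))^α`."

* **Definition 3.1** (p. 20): `‖v‖_{C^{α,α/2}(M_{r_*,R})} := ‖v‖_{C⁰} + [v]_{α,α/2}` and
  `‖v‖_{C^{2+α,1+α/2}(M_{r_*,R})} := ‖v‖_{C⁰} + ‖D̸v‖_{C⁰} + ‖D̸²v‖_{C⁰} + ‖v_s‖_{C⁰} + [D̸²v]_{α,α/2} + [v_s]_{α,α/2}`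
  — `czNorm`, `ctNorm`.
* **Definition 3.2** (p. 20): `‖v‖_{C^{2+α,1+α/2}_{-σ}} := ‖e^{-σ s} v‖_{C^{2+α,1+α/2}}`,
  `‖v‖_{C^{α,α/2}_{-σ}} := ‖e^{-σ s} v‖_{C^{α,α/2}}` ("since `e^{-σ s} = r^σ` … the notation corresponds
  to decay like `r^{-σ}`") — `ctWeightedNorm`, `czWeightedNorm` (weight `rpowWeight σ v = r^σ v`).
* **Definition 3.4** (p. 20, "a strengthened weighted tail space"): `‖v‖_{C^{2+α,1+α/2,♯}_{-σ}(M_{r_*,R})}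
  := ‖v‖_{C^{2+α,1+α/2}_{-σ}} + ∑_{j=3}^{4} ‖r^σ D̸^j v‖_{C⁰} + ∑_{ℓ=1}^{3} ∑_{j=0}^{3-ℓ} ‖r^{σ+ℓ} ∂_r^ℓ D̸^j v‖_{C^{α,α/2}}`
  — `ctSharpWeightedNorm`.
* "Tensor-valued spaces. By abuse of notation we use the same symbols … for tensor fields whose
  components, in any fixed `γ_{S²}`-orthonormal frame, belong to the corresponding spaces.
  Different frame choices give equivalent norms." (p. 20) — here: `W`-valued functions for an
  arbitrary real normed space `W` (components in the fixed ambient frame of `E3`; equivalent norms,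
  see DESIGN).

## Design (rendering choices; every one produces norms EQUIVALENT to the printed ones, and the
## printed conditions `< ∞`, `→ 0` of Defs. 3.6–3.29 are invariant under norm equivalence)

* Points of the tail are pairs `(r, p)`, `r` in a radial index set `J ⊆ (0, ∞)` (the print's
  `(r_*, R]`; Defs. 3.6–3.29 only use the open fixed tails `J = Ioi r₁`), `p ∈ S² =
  Metric.sphere (0 : E3) 1`; a "function on `M_{r_*,R}`" is `v : ℝ → S² → W` (junk off `J`). The
  logarithmic variable enters only through `|s - s'| = |log r - log r'|` and `v_s = -r ∂_r v`
  (print (3.2): `∂_s = -r ∂_r`).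
* `d_{γ_{S²}}(x, y)` = the great-circle distance = the angle `InnerProductGeometry.angle x y`
  (intrinsic distance of the round unit sphere). [folklore]
* **`D̸` is rendered EXACTLY** (Gauss formula for `S² ⊂ E3`): a tangential `k`-tensor at `p` is an
  ambient `k`-linear map on `E3` all of whose slots are pre-composed with the orthogonal projection
  `Π_p` onto `p^⊥` (`sphereTanProj p`, `X ↦ X - ⟪p, X⟫ p`), and
  `D̸^{k+1} v (p) = [d(D̸^k v ∘ ray)_p] ∘ (Π_p, …, Π_p)` (`sphereCovDeriv`; `ray y = y/‖y‖`): for the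
  Levi-Civita connection of a submanifold, `(∇̸_X T)(Y…) = (∂_X T̃)(Y…)` on tangent vectors, the
  choice of extension `T̃` off the sphere being immaterial. For `W`-valued `v` this is the
  componentwise covariant derivative (the print's frame-component convention).
* Norms are `ℝ≥0∞`-valued suprema; the norms of Def. 3.1/3.4 display derivatives (`fderiv`,
  `deriv`, `iteratedDeriv` have junk values), so they are set to `⊤` off an explicit
  differentiability guard (`CtRegularOn`, `CtSharpRegularOn`) — finiteness of a norm therefore
  includes the classical existence of every derivative it displays (the pattern of
  `Literature.Analysis.PDE.ParabolicHolderNorm`). Tensor norms are operator norms of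
  (multi)linear maps (the print does not fix a fibre norm; all choices are equivalent).
* NOT here: Lemma 3.3 (derivative decay from the logarithmic definition), completeness /
  interpolation of these spaces, the coefficient classes (Defs. 3.6, 3.8: file
  `ADMTailCoefficientClass`), forcing decay / gauge reducibility (Defs. 3.28, 3.29).

## References

* [Ellithy2026] A. Ellithy, *The spacetime Penrose inequality under a quasi final state
  hypothesis*, arXiv:2605.18730 (2026), §3.1, Definitions 3.1, 3.2, 3.4, p. 20.
* G. Lieberman, *Second order parabolic differential equations* (1996), Ch. IV §1 (parabolic
  Hölder spaces). [folklore]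
-/

noncomputable section

open Set Metric Function
open scoped ENNReal NNReal Topology ContDiff RealInnerProductSpace

namespace Literature.Geometry.Lorentzian

/-! ### The unit sphere `S² ⊂ E3`: radial retraction and exact angular covariant derivatives -/

section Sphere

variable {W : Type*} [NormedAddCommGroup W] [NormedSpace ℝ W]

/-- **The orthogonal projection `Π_p : E3 → p^⊥ = T_p S²`** for a point `p` of the unit sphere:
`Π_p X = X - ⟪p, X⟫ p`, as a continuous linear map (for `‖p‖ = 1` this is the orthogonal projection
onto the tangent plane; cf. `Literature.Geometry.Riemannian.radialProj`, the same map with the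
normalisation `‖p‖⁻²` for arbitrary `p`). [folklore] -/
def sphereTanProj (p : E3) : E3 →L[ℝ] E3 :=
  ContinuousLinearMap.id ℝ E3 - (innerSL ℝ p).smulRight p

/-- Unfolding: `Π_p X = X - ⟪p, X⟫ p`. [folklore] -/
@[simp] private theorem sphereTanProj_apply (p X : E3) : sphereTanProj p X = X - ⟪p, X⟫ • p := by
  simp [sphereTanProj, ContinuousLinearMap.smulRight_apply, innerSL_apply_apply]

/-- `Π_p p = 0` for a unit vector `p`. [folklore] -/
private theorem sphereTanProj_apply_self {p : E3} (hp : ‖p‖ = 1) : sphereTanProj p p = 0 := by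
  rw [sphereTanProj_apply, real_inner_self_eq_norm_sq, hp, one_pow, one_smul, sub_self]

/-- `Π_p X = X` for `X ⊥ p`. [folklore] -/
private theorem sphereTanProj_apply_of_inner_eq_zero {p X : E3} (h : ⟪p, X⟫ = 0) : sphereTanProj p X = X := by
  rw [sphereTanProj_apply, h, zero_smul, sub_zero]

/-- `Π_p X ⊥ p` for a unit vector `p`. [folklore] -/
private theorem inner_sphereTanProj {p : E3} (hp : ‖p‖ = 1) (X : E3) : ⟪p, sphereTanProj p X⟫ = 0 := by
  rw [sphereTanProj_apply, inner_sub_right, inner_smul_right, real_inner_self_eq_norm_sq, hp,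
    one_pow, mul_one, sub_self]

/-- The north pole `e₀ ∈ S²` (junk value of the radial retraction at the origin). [folklore] -/
def northPole : sphere (0 : E3) 1 :=
  ⟨EuclideanSpace.single 0 1, by simp⟩

/-- The **radial retraction** `ray : E3 → S²`, `y ↦ y / ‖y‖` (junk value `northPole` at `y = 0`);
identifies `E3 ∖ {0}` with `(0, ∞) × S²`, `y = r p`, as in the print's `M ≅ (r₀, ∞) × S²`
(Ellithy 2026, §3.1, p. 20). [cite: Ellithy2026, §3.1 p. 20] -/
def raySphere (y : E3) : sphere (0 : E3) 1 :=
  if h : y = 0 then northPole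
  else ⟨‖y‖⁻¹ • y, by
    rw [mem_sphere_zero_iff_norm, norm_smul, norm_inv, norm_norm,
      inv_mul_cancel₀ (norm_ne_zero_iff.mpr h)]⟩

/-- `ray y = y / ‖y‖` for `y ≠ 0`. [folklore] -/
private theorem coe_raySphere {y : E3} (hy : y ≠ 0) : (raySphere y : E3) = ‖y‖⁻¹ • y := by
  simp [raySphere, hy]

/-- `ray p = p` on the sphere. [folklore] -/
private theorem raySphere_coe (p : sphere (0 : E3) 1) : raySphere (p : E3) = p := by
  have hp : ‖(p : E3)‖ = 1 := by simp
  have hp0 : (p : E3) ≠ 0 := by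
    intro h; rw [h, norm_zero] at hp; exact zero_ne_one hp
  ext1
  rw [coe_raySphere hp0, hp, inv_one, one_smul]

/-- **The `k`-th angular covariant derivative `D̸^k v`** of a `W`-valued function on `S²` with
respect to the Levi-Civita connection `D̸` of the round metric `γ_{S²}` (Ellithy 2026, §3.1, p. 20:
"fix … the round metric `γ_{S²}`, and let `D̸` denote its Levi–Civita connection"), in the ambient
rendering: `D̸⁰ v (p) = v p` and
`D̸^{k+1} v (p) (X₀, X₁, …, X_k) = d(D̸^k v ∘ ray)_p (Π_p X₀) (Π_p X₁, …, Π_p X_k)` — the Gauss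
formula `∇̸_X T = (∂_X T̃)^{tan}` for the unit sphere in `E3`, all slots projected to `T_p S² = p^⊥`
by `sphereTanProj p`; the recursion is Mathlib's `iteratedFDeriv` with the projections inserted.
Junk (`fderiv = 0`) where the previous stage is not differentiable; see `SphereDiffAt`.
[cite: Ellithy2026, §3.1 p. 20] -/
def sphereCovDeriv : (k : ℕ) → (sphere (0 : E3) 1 → W) → sphere (0 : E3) 1 → E3 [×k]→L[ℝ] W
  | 0 => fun v p ↦ ContinuousMultilinearMap.uncurry0 ℝ E3 (v p)
  | k + 1 => fun v p ↦
      (ContinuousLinearMap.uncurryLeft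
          (fderiv ℝ (fun y : E3 ↦ sphereCovDeriv k v (raySphere y)) (p : E3))).compContinuousLinearMap
        fun _ ↦ sphereTanProj (p : E3)

/-- `D̸⁰ v (p) = v p` (order zero of the print's `D̸`, Ellithy 2026, §3.1, p. 20).
[cite: Ellithy2026, §3.1 p. 20] -/
@[simp] theorem sphereCovDeriv_zero_apply (v : sphere (0 : E3) 1 → W) (p : sphere (0 : E3) 1)
    (m : Fin 0 → E3) : sphereCovDeriv 0 v p m = v p := rfl

/-- Unfolding of the successor step (the Gauss formula for the round connection `D̸` of Ellithy
2026, §3.1, p. 20): `D̸^{k+1} v (p) m = d(D̸^k v ∘ ray)_p (Π_p (m 0)) (Π_p ∘ tail m)`.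
[cite: Ellithy2026, §3.1 p. 20] -/
theorem sphereCovDeriv_succ_apply (k : ℕ) (v : sphere (0 : E3) 1 → W) (p : sphere (0 : E3) 1)
    (m : Fin (k + 1) → E3) :
    sphereCovDeriv (k + 1) v p m =
      fderiv ℝ (fun y : E3 ↦ sphereCovDeriv k v (raySphere y)) (p : E3) (sphereTanProj (p : E3) (m 0))
        (fun i ↦ sphereTanProj (p : E3) (m i.succ)) := rfl

/-- **Angular differentiability guard**: `v` is `k` times angularly differentiable at `p` — every
one of the first `k` stages `y ↦ D̸^j v (ray y)`, `j < k`, of `sphereCovDeriv` is Fréchet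
differentiable at `p`, so that `D̸^j v (p)`, `j ≤ k`, are classical covariant derivatives (the
regularity implicit in the print's `‖D̸ v‖_{C⁰}, ‖D̸² v‖_{C⁰}` of Def. 3.1 and `D̸³ v, D̸⁴ v` of Def. 3.4).
[cite: Ellithy2026, Def. 3.1 p. 20] -/
def SphereDiffAt (k : ℕ) (v : sphere (0 : E3) 1 → W) (p : sphere (0 : E3) 1) : Prop :=
  ∀ j < k, DifferentiableAt ℝ (fun y : E3 ↦ sphereCovDeriv j v (raySphere y)) (p : E3)

/-- The guard is monotone in the order. [folklore] -/
private theorem SphereDiffAt.of_le {k k' : ℕ} {v : sphere (0 : E3) 1 → W} {p : sphere (0 : E3) 1}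
    (h : SphereDiffAt k v p) (hk : k' ≤ k) : SphereDiffAt k' v p :=
  fun j hj ↦ h j (lt_of_lt_of_le hj hk)

/-- Order `0` is no condition. [folklore] -/
@[simp] private theorem sphereDiffAt_zero (v : sphere (0 : E3) 1 → W) (p : sphere (0 : E3) 1) :
    SphereDiffAt 0 v p := fun _ hj ↦ (Nat.not_lt_zero _ hj).elim

end Sphere

/-! ### Functions on a tail `J × S²`: sup norm, parabolic Hölder seminorm (Def. 3.1) -/

section Tail

variable {W : Type*} [NormedAddCommGroup W] [NormedSpace ℝ W]

/-- **The parabolic distance in the `s`-variable** between two points `(r, p)`, `(r', p')` of the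
exterior region: `d_p((s,x),(s',y)) := d_{γ_{S²}}(x,y) + |s - s'|^{1/2}` with `s = -log r`
(Ellithy 2026, §3.1, display before Def. 3.1, p. 20); `d_{γ_{S²}}` = great-circle distance = the
angle. Meant for `r, r' > 0`. [cite: Ellithy2026, §3.1 p. 20] -/
def logParabolicDist (z z' : ℝ × sphere (0 : E3) 1) : ℝ :=
  InnerProductGeometry.angle (z.2 : E3) (z'.2 : E3) + Real.sqrt |Real.log z.1 - Real.log z'.1|

/-- The parabolic distance is symmetric. [folklore] -/
private theorem logParabolicDist_comm (z z' : ℝ × sphere (0 : E3) 1) :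
    logParabolicDist z z' = logParabolicDist z' z := by
  rw [logParabolicDist, logParabolicDist, InnerProductGeometry.angle_comm, abs_sub_comm]

/-- The parabolic distance is nonnegative. [folklore] -/
private theorem logParabolicDist_nonneg (z z' : ℝ × sphere (0 : E3) 1) : 0 ≤ logParabolicDist z z' :=
  add_nonneg (InnerProductGeometry.angle_nonneg _ _) (Real.sqrt_nonneg _)

/-- **The sup norm `‖v‖_{C⁰(M_J)}`** of a `W`-valued function on the tail `J × S²`, in `[0, ∞]`
(Ellithy 2026, Def. 3.1, p. 20). [cite: Ellithy2026, Def. 3.1 p. 20] -/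
def tailSupNorm (J : Set ℝ) (v : ℝ → sphere (0 : E3) 1 → W) : ℝ≥0∞ :=
  ⨆ r ∈ J, ⨆ p : sphere (0 : E3) 1, ‖v r p‖ₑ

omit [NormedSpace ℝ W] in
/-- Pointwise bound by the sup norm `‖v‖_{C⁰(M_J)}` of Def. 3.1 (Ellithy 2026, p. 20).
[cite: Ellithy2026, Def. 3.1 p. 20] -/
theorem enorm_le_tailSupNorm (J : Set ℝ) (v : ℝ → sphere (0 : E3) 1 → W) {r : ℝ} (hr : r ∈ J)
    (p : sphere (0 : E3) 1) : ‖v r p‖ₑ ≤ tailSupNorm J v :=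
  le_iSup₂_of_le (f := fun r (_ : r ∈ J) ↦ ⨆ p : sphere (0 : E3) 1, ‖v r p‖ₑ) r hr
    (le_iSup (fun p : sphere (0 : E3) 1 ↦ ‖v r p‖ₑ) p)

/-- **The parabolic Hölder seminorm `[v]_{α,α/2;M_J}`**
`= sup_{(r,p) ≠ (r',p'), r, r' ∈ J} ‖v(r,p) - v(r',p')‖ / d_p((r,p),(r',p'))^α`, in `[0, ∞]`
(Ellithy 2026, §3.1, display before Def. 3.1, p. 20). [cite: Ellithy2026, §3.1 p. 20] -/
def tailHolderSeminorm (α : ℝ) (J : Set ℝ) (v : ℝ → sphere (0 : E3) 1 → W) : ℝ≥0∞ :=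
  ⨆ (z : ℝ × sphere (0 : E3) 1) (z' : ℝ × sphere (0 : E3) 1) (_ : z.1 ∈ J) (_ : z'.1 ∈ J)
    (_ : z ≠ z'), ‖v z.1 z.2 - v z'.1 z'.2‖ₑ / ENNReal.ofReal (logParabolicDist z z' ^ α)

omit [NormedSpace ℝ W] in
/-- The Hölder quotient of two tail points is bounded by the seminorm `[v]_{α,α/2;M_J}` (Ellithy 2026,
§3.1, p. 20). [cite: Ellithy2026, §3.1 p. 20] -/
theorem holderQuotient_le_tailHolderSeminorm (α : ℝ) (J : Set ℝ) (v : ℝ → sphere (0 : E3) 1 → W)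
    {z z' : ℝ × sphere (0 : E3) 1} (hz : z.1 ∈ J) (hz' : z'.1 ∈ J) (hne : z ≠ z') :
    ‖v z.1 z.2 - v z'.1 z'.2‖ₑ / ENNReal.ofReal (logParabolicDist z z' ^ α) ≤
      tailHolderSeminorm α J v := by
  unfold tailHolderSeminorm
  exact le_iSup_of_le z <| le_iSup_of_le z' <| le_iSup_of_le hz <| le_iSup_of_le hz' <|
    le_iSup_of_le hne le_rfl

omit [NormedSpace ℝ W] in
/-- The Hölder seminorm of a constant vanishes. [folklore] -/
@[simp] private theorem tailHolderSeminorm_const (α : ℝ) (J : Set ℝ) (c : W) :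
    tailHolderSeminorm α J (fun _ _ ↦ c) = 0 := by
  simp [tailHolderSeminorm]

/-- **`‖v‖_{C^{α,α/2}(M_J)} := ‖v‖_{C⁰(M_J)} + [v]_{α,α/2;M_J}`** (Ellithy 2026, Def. 3.1, p. 20).
[cite: Ellithy2026, Def. 3.1 p. 20] -/
def czNorm (α : ℝ) (J : Set ℝ) (v : ℝ → sphere (0 : E3) 1 → W) : ℝ≥0∞ :=
  tailSupNorm J v + tailHolderSeminorm α J v

/-- **The `s`-derivative `v_s = ∂_s v = -r ∂_r v`** (`s = -log r`, print (3.2) `∂_s = -r ∂_r`,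
p. 20); `deriv` in the radial variable at fixed `p` (junk `0` where not differentiable).
[cite: Ellithy2026, §3.1 (3.2) p. 20] -/
def sDeriv (v : ℝ → sphere (0 : E3) 1 → W) : ℝ → sphere (0 : E3) 1 → W :=
  fun r p ↦ -(r • deriv (fun ρ ↦ v ρ p) r)

/-- **`D̸^k v` on the tail**: `(r, p) ↦ D̸^k (v(r, ·)) (p)` (angular covariant derivatives at fixed
radius). [cite: Ellithy2026, Def. 3.1 p. 20] -/
def angPart (k : ℕ) (v : ℝ → sphere (0 : E3) 1 → W) :
    ℝ → sphere (0 : E3) 1 → E3 [×k]→L[ℝ] W :=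
  fun r p ↦ sphereCovDeriv k (v r) p

/-- **`∂_r^ℓ D̸^j v` on the tail**: the `ℓ`-th radial derivative (`iteratedDeriv`) of
`r ↦ D̸^j (v(r, ·)) (p)` (Ellithy 2026, Def. 3.4, p. 20). [cite: Ellithy2026, Def. 3.4 p. 20] -/
def radAngPart (ℓ j : ℕ) (v : ℝ → sphere (0 : E3) 1 → W) :
    ℝ → sphere (0 : E3) 1 → E3 [×j]→L[ℝ] W :=
  fun r p ↦ iteratedDeriv ℓ (fun ρ ↦ sphereCovDeriv j (v ρ) p) r

/-- **The weight `e^{-σ s} v = r^σ v`** (Ellithy 2026, Def. 3.2, p. 20: "since `e^{-σs} = r^σ`").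
[cite: Ellithy2026, Def. 3.2 p. 20] -/
def rpowWeight (σ : ℝ) (v : ℝ → sphere (0 : E3) 1 → W) : ℝ → sphere (0 : E3) 1 → W :=
  fun r p ↦ (r ^ σ) • v r p

/-- Unfolding of the weight `e^{-σ s} v = r^σ v` (Ellithy 2026, Def. 3.2, p. 20).
[cite: Ellithy2026, Def. 3.2 p. 20] -/
@[simp] theorem rpowWeight_apply (σ : ℝ) (v : ℝ → sphere (0 : E3) 1 → W) (r : ℝ)
    (p : sphere (0 : E3) 1) : rpowWeight σ v r p = (r ^ σ) • v r p := rfl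

/-- Weight `0` is the identity on `J ⊆ (0, ∞)` (indeed for all `r`, as `r ^ (0:ℝ) = 1`). [folklore] -/
@[simp] private theorem rpowWeight_zero (v : ℝ → sphere (0 : E3) 1 → W) : rpowWeight 0 v = v := by
  funext r p; simp [rpowWeight]

/-- **Regularity guard of `C^{2+α,1+α/2}(M_J)`**: on the tail, `D̸v`, `D̸²v` exist (every `v(r,·)`,
`r ∈ J`, is twice angularly differentiable) and `v_s` exists (every `v(·, p)` is differentiable at
the points of `J`; `J` is meant to be open, as the fixed tails `Ioi r₁` of Defs. 3.6–3.29) — the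
regularity implicit in Def. 3.1's displayed `D̸v, D̸²v, v_s` (Ellithy 2026, p. 20).
[cite: Ellithy2026, Def. 3.1 p. 20] -/
def CtRegularOn (J : Set ℝ) (v : ℝ → sphere (0 : E3) 1 → W) : Prop :=
  (∀ r ∈ J, ∀ p : sphere (0 : E3) 1, SphereDiffAt 2 (v r) p) ∧
    ∀ r ∈ J, ∀ p : sphere (0 : E3) 1, DifferentiableAt ℝ (fun ρ ↦ v ρ p) r

open scoped Classical in
/-- **`‖v‖_{C^{2+α,1+α/2}(M_J)} := ‖v‖_{C⁰} + ‖D̸v‖_{C⁰} + ‖D̸²v‖_{C⁰} + ‖v_s‖_{C⁰} + [D̸²v]_{α,α/2}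
+ [v_s]_{α,α/2}`** (Ellithy 2026, Def. 3.1, p. 20), in `[0, ∞]`, with the value `⊤` when the guard
`CtRegularOn J v` fails (so that a finite norm certifies that the displayed derivatives exist).
[cite: Ellithy2026, Def. 3.1 p. 20] -/
def ctNorm (α : ℝ) (J : Set ℝ) (v : ℝ → sphere (0 : E3) 1 → W) : ℝ≥0∞ :=
  if CtRegularOn J v then
    tailSupNorm J v + tailSupNorm J (angPart 1 v) + tailSupNorm J (angPart 2 v)
      + tailSupNorm J (sDeriv v) + tailHolderSeminorm α J (angPart 2 v)
      + tailHolderSeminorm α J (sDeriv v)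
  else ⊤

/-- Off the regularity guard the `C^{2+α,1+α/2}` norm of Def. 3.1 is `⊤` (Ellithy 2026, p. 20;
rendering convention). [cite: Ellithy2026, Def. 3.1 p. 20] -/
theorem ctNorm_of_not_regular {α : ℝ} {J : Set ℝ} {v : ℝ → sphere (0 : E3) 1 → W}
    (h : ¬ CtRegularOn J v) : ctNorm α J v = ⊤ := by
  simp [ctNorm, h]

/-- A finite `C^{2+α,1+α/2}` norm (Def. 3.1, p. 20) certifies the regularity guard.
[cite: Ellithy2026, Def. 3.1 p. 20] -/
theorem ctRegularOn_of_ctNorm_lt_top {α : ℝ} {J : Set ℝ} {v : ℝ → sphere (0 : E3) 1 → W}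
    (h : ctNorm α J v < ⊤) : CtRegularOn J v := by
  by_contra hreg
  exact h.ne (ctNorm_of_not_regular hreg)

/-- `‖v‖_{C⁰} ≤ ‖v‖_{C^{2+α,1+α/2}}` (Def. 3.1, p. 20: the latter is the former plus nonnegative
terms). [cite: Ellithy2026, Def. 3.1 p. 20] -/
theorem tailSupNorm_le_ctNorm (α : ℝ) (J : Set ℝ) (v : ℝ → sphere (0 : E3) 1 → W) :
    tailSupNorm J v ≤ ctNorm α J v := by
  by_cases h : CtRegularOn J v
  · simp only [ctNorm, h, if_true]
    calc tailSupNorm J v ≤ tailSupNorm J v + tailSupNorm J (angPart 1 v) + tailSupNorm J (angPart 2 v)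
          + tailSupNorm J (sDeriv v) + tailHolderSeminorm α J (angPart 2 v) := by
            simp only [add_assoc]; exact le_self_add
      _ ≤ _ := le_self_add
  · simp [ctNorm, h]

/-! ### Weighted spaces (Def. 3.2) and the strengthened tail space (Def. 3.4) -/

/-- **`‖v‖_{C^{2+α,1+α/2}_{-σ}(M_J)} := ‖e^{-σ s} v‖_{C^{2+α,1+α/2}(M_J)} = ‖r^σ v‖_{C^{2+α,1+α/2}(M_J)}`**
(Ellithy 2026, Def. 3.2, p. 20: "corresponds to decay like `r^{-σ}`"). [cite: Ellithy2026, Def. 3.2 p. 20] -/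
def ctWeightedNorm (α σ : ℝ) (J : Set ℝ) (v : ℝ → sphere (0 : E3) 1 → W) : ℝ≥0∞ :=
  ctNorm α J (rpowWeight σ v)

/-- **`‖v‖_{C^{α,α/2}_{-σ}(M_J)} := ‖e^{-σ s} v‖_{C^{α,α/2}(M_J)} = ‖r^σ v‖_{C^{α,α/2}(M_J)}`**
(Ellithy 2026, Def. 3.2, p. 20). [cite: Ellithy2026, Def. 3.2 p. 20] -/
def czWeightedNorm (α σ : ℝ) (J : Set ℝ) (v : ℝ → sphere (0 : E3) 1 → W) : ℝ≥0∞ :=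
  czNorm α J (rpowWeight σ v)

/-- Weight `0`: the weighted norms are the unweighted ones. [folklore] -/
@[simp] private theorem ctWeightedNorm_zero (α : ℝ) (J : Set ℝ) (v : ℝ → sphere (0 : E3) 1 → W) :
    ctWeightedNorm α 0 J v = ctNorm α J v := by
  simp [ctWeightedNorm]

/-- Weight `0`: the weighted norms are the unweighted ones. [folklore] -/
@[simp] private theorem czWeightedNorm_zero (α : ℝ) (J : Set ℝ) (v : ℝ → sphere (0 : E3) 1 → W) :
    czWeightedNorm α 0 J v = czNorm α J v := by
  simp [czWeightedNorm]

/-- **Regularity guard of the strengthened space `C^{2+α,1+α/2,♯}_{-σ}`** (Def. 3.4 displays `D̸³v`,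
`D̸⁴v` and `∂_r^ℓ D̸^j v`, `1 ≤ ℓ ≤ 3`, `0 ≤ j ≤ 3 - ℓ`): every `v(r, ·)`, `r ∈ J`, is four times
angularly differentiable, and `r ↦ D̸^j v(r, ·)(p)` is `ℓ` times differentiable at the points of `J`
(all lower iterated derivatives differentiable) for those `ℓ, j` (Ellithy 2026, Def. 3.4, p. 20).
[cite: Ellithy2026, Def. 3.4 p. 20] -/
def CtSharpRegularOn (J : Set ℝ) (v : ℝ → sphere (0 : E3) 1 → W) : Prop :=
  (∀ r ∈ J, ∀ p : sphere (0 : E3) 1, SphereDiffAt 4 (v r) p) ∧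
    ∀ ℓ j : ℕ, 1 ≤ ℓ → ℓ ≤ 3 → j ≤ 3 - ℓ → ∀ r ∈ J, ∀ p : sphere (0 : E3) 1, ∀ m < ℓ,
      DifferentiableAt ℝ (iteratedDeriv m (fun ρ ↦ sphereCovDeriv j (v ρ) p)) r

open scoped Classical in
/-- **The strengthened weighted tail norm** (Ellithy 2026, Def. 3.4, p. 20):
`‖v‖_{C^{2+α,1+α/2,♯}_{-σ}(M_J)} := ‖v‖_{C^{2+α,1+α/2}_{-σ}(M_J)} + ∑_{j=3}^{4} ‖r^σ D̸^j v‖_{C⁰(M_J)}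
+ ∑_{ℓ=1}^{3} ∑_{j=0}^{3-ℓ} ‖r^{σ+ℓ} ∂_r^ℓ D̸^j v‖_{C^{α,α/2}(M_J)}`, in `[0, ∞]`, `⊤` off the guard
`CtSharpRegularOn J v`. (Remark 3.5: "used only in the gauge-reduction argument … to record the
extra tangential and mixed radial/tangential regularity".) [cite: Ellithy2026, Def. 3.4 p. 20] -/
def ctSharpWeightedNorm (α σ : ℝ) (J : Set ℝ) (v : ℝ → sphere (0 : E3) 1 → W) : ℝ≥0∞ :=
  if CtSharpRegularOn J v then
    ctWeightedNorm α σ J v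
      + ∑ j ∈ Finset.Icc 3 4, tailSupNorm J (rpowWeight σ (angPart j v))
      + ∑ ℓ ∈ Finset.Icc 1 3, ∑ j ∈ Finset.range (4 - ℓ),
          czNorm α J (rpowWeight (σ + ℓ) (radAngPart ℓ j v))
  else ⊤

/-- Off the `♯`-regularity guard the strengthened norm of Def. 3.4 (p. 20) is `⊤` (rendering
convention). [cite: Ellithy2026, Def. 3.4 p. 20] -/
theorem ctSharpWeightedNorm_of_not_regular {α σ : ℝ} {J : Set ℝ}
    {v : ℝ → sphere (0 : E3) 1 → W} (h : ¬ CtSharpRegularOn J v) :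
    ctSharpWeightedNorm α σ J v = ⊤ := by
  simp [ctSharpWeightedNorm, h]

/-- The strengthened norm dominates the weighted `C^{2+α,1+α/2}_{-σ}` norm (Def. 3.4, p. 20, adds
nonnegative terms to it). [cite: Ellithy2026, Def. 3.4 p. 20] -/
theorem ctWeightedNorm_le_ctSharpWeightedNorm (α σ : ℝ) (J : Set ℝ)
    (v : ℝ → sphere (0 : E3) 1 → W) : ctWeightedNorm α σ J v ≤ ctSharpWeightedNorm α σ J v := by
  by_cases h : CtSharpRegularOn J v
  · simp only [ctSharpWeightedNorm, h, if_true, add_assoc]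
    exact le_self_add
  · simp [ctSharpWeightedNorm, h]

/-- **Membership in `C^{2+α,1+α/2}(M̄_{r_*,R})`-type classes is finiteness of the norm**: the print's
"`v ∈ C^{2+α,1+α/2}_{-σ}(M_{r_*,R}) ⟺ r^σ v ∈ C^{2+α,1+α/2}(M_{r_*,R})`" (Def. 3.2, p. 20) holds by
definition of the weighted norm. [cite: Ellithy2026, Def. 3.2 p. 20] -/
theorem ctWeightedNorm_lt_top_iff (α σ : ℝ) (J : Set ℝ) (v : ℝ → sphere (0 : E3) 1 → W) :
    ctWeightedNorm α σ J v < ⊤ ↔ ctNorm α J (rpowWeight σ v) < ⊤ := Iff.rfl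

end Tail

end Literature.Geometry.Lorentzian

end
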